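import Mathlib
import Literature.RepresentationTheory.FiniteGroups.InducedClassFunction
import Literature.RepresentationTheory.FiniteGroups.BrauerInduction
import Literature.RepresentationTheory.FiniteGroups.RepresentationRing
import Summits.MatrixMultiplication.MatrixMultiplication.Theorems.SubgroupIdentityDesigns.Negative.ParabolicSubgroup

/-!
# Harish-Chandra induction `I^a_c` and restriction `r^a_c` for the maximal parabolics of `GL_a(F)`

Supports stmt-MatrixMultiplication-14079 (route `LevelGradedCohnUmans`, crux `SubgroupIdentityDesigns`).
VALUE = theorem (infrastructure for the hook unipotent character `χ^{(l,1^k)}` that closes the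
block-slice corner of `BlockSliceSummary` for all primes), NOT summit progress.

With `P^a_c = parab F a c`, `Q^a_c = fixer F a c`, `ul : P^a_c →* GL_c(F)` (`ParabolicSubgroup`):
* `hcInd hc σ = Ind_{P^a_c}^{G_a} (σ ∘ ul)` — **Harish-Chandra (parabolic) induction** of a function
  `σ` on `GL_c(F)` (inflate `σ ⊠ 1_{GL_{a-c}}` to `P^a_c`, then induce; `indClassFun`);
* `hcRes hc Φ (x) = |Q^a_c|⁻¹ ∑_{g ∈ P^a_c, ul g = x} Φ(g)` — **Harish-Chandra restriction**
  (average of `Φ` over the `Q^a_c`-coset of matrices whose first `c` columns are `(x; 0)`);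
* `classInner_hcInd_right` — the **adjunction** `⟨Φ, I^a_c τ⟩_{G_a} = ⟨r^a_c Φ, τ⟩_{G_c}` for a
  class function `Φ` (Frobenius reciprocity `classInner_indClassFun_right` + fibrewise summation
  along `ul`), and `classInner_hcInd_left`;
* `isClassFun_hcInd`, `isClassFun_hcRes` — both operations preserve class functions;
* `hcInd_apply_one` — `(I^a_c σ)(1) = [G_a : P^a_c] σ(1)`; `hcInd_self`, `hcRes_self`; linearity.

These are the two functors of Harish-Chandra's philosophy of cusp forms for the maximal parabolic
subgroups of `GL_n` over a finite field (Harish-Chandra 1970; Springer, *Cusp forms for finite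
groups*, in: Borel et al., LNM 131 (1970); Zelevinsky, LNM 869 (1981) §9; Digne–Michel,
*Representations of Finite Groups of Lie Type*, Ch. 4–6), in the elementary class-function
language of the topic files.  The Mackey formula relating them is the subject of the sequel.
-/

set_option linter.dupNamespace false

noncomputable section

open scoped BigOperators Matrix Classical
open Literature.RepresentationTheory.FiniteGroups

namespace Summit.MatrixMultiplication.MatrixMultiplication.Theorems.SubgroupIdentityDesigns.Negative
namespace ParabolicRestriction

open ParabolicSubgroup

variable {F : Type} [Field F] [Fintype F] [DecidableEq F] {a c : ℕ}

/-! ## Harish-Chandra induction and restriction -/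

/-- **Harish-Chandra induction** `I^a_c σ = Ind_{P^a_c}^{GL_a} (σ ∘ ul)` of a function `σ` on
`GL_c(F)` (inflation of `σ ⊠ 1` to the parabolic, then induction). -/
def hcInd (hc : c ≤ a) (σ : GL (Fin c) F → ℂ) : GL (Fin a) F → ℂ :=
  indClassFun (parab F a c) (fun g => σ (ul hc g))

/-- **Harish-Chandra restriction** `r^a_c Φ (x) = |Q^a_c|⁻¹ ∑_{g ∈ P^a_c, ul g = x} Φ(g)`
(the `U`-average of `Φ` over the matrices with first `c` columns `(x ; 0)`). -/
def hcRes (hc : c ≤ a) (Φ : GL (Fin a) F → ℂ) (x : GL (Fin c) F) : ℂ :=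
  (Nat.card (fixer F a c) : ℂ)⁻¹ * ∑ g : parab F a c, if ul hc g = x then Φ g else 0

/-- `I^a_c σ` is a class function. -/
theorem isClassFun_hcInd (hc : c ≤ a) (σ : GL (Fin c) F → ℂ) : IsClassFun (hcInd hc σ) :=
  isClassFun_indClassFun _ _

/-- `I^a_c` is additive. -/
theorem hcInd_add (hc : c ≤ a) (σ τ : GL (Fin c) F → ℂ) :
    hcInd hc (σ + τ) = hcInd hc σ + hcInd hc τ := by
  unfold hcInd
  rw [← indClassFun_add]
  rfl

/-- `I^a_c` is homogeneous. -/
theorem hcInd_smul (hc : c ≤ a) (r : ℂ) (σ : GL (Fin c) F → ℂ) :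
    hcInd hc (r • σ) = r • hcInd hc σ := by
  unfold hcInd
  rw [← indClassFun_smul]
  rfl

/-- `I^a_c 0 = 0`. -/
theorem hcInd_zero (hc : c ≤ a) : hcInd hc (0 : GL (Fin c) F → ℂ) = 0 := by
  unfold hcInd
  rw [← indClassFun_zero (H := parab F a c)]
  rfl

/-- `I^a_c (-σ) = - I^a_c σ`. -/
theorem hcInd_neg (hc : c ≤ a) (σ : GL (Fin c) F → ℂ) : hcInd hc (-σ) = -hcInd hc σ := by
  rw [← neg_one_smul ℂ σ, hcInd_smul, neg_one_smul]

/-- `I^a_c (σ - τ) = I^a_c σ - I^a_c τ`. -/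
theorem hcInd_sub (hc : c ≤ a) (σ τ : GL (Fin c) F → ℂ) :
    hcInd hc (σ - τ) = hcInd hc σ - hcInd hc τ := by
  rw [sub_eq_add_neg, hcInd_add, hcInd_neg, ← sub_eq_add_neg]

/-- `I^a_c` of a finite sum. -/
theorem hcInd_sum (hc : c ≤ a) {ι : Type} (S : Finset ι) (σ : ι → GL (Fin c) F → ℂ) :
    hcInd hc (∑ i ∈ S, σ i) = ∑ i ∈ S, hcInd hc (σ i) := by
  induction S using Finset.induction_on with
  | empty => simp [hcInd_zero]
  | insert i S hi ih => rw [Finset.sum_insert hi, Finset.sum_insert hi, hcInd_add, ih]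

/-- `r^a_c` is additive. -/
theorem hcRes_add (hc : c ≤ a) (Φ Ψ : GL (Fin a) F → ℂ) :
    hcRes hc (Φ + Ψ) = hcRes hc Φ + hcRes hc Ψ := by
  funext x
  simp only [hcRes, Pi.add_apply]
  rw [← mul_add, ← Finset.sum_add_distrib]
  congr 1
  refine Finset.sum_congr rfl fun g _ => ?_
  split_ifs <;> simp

/-- `r^a_c` is homogeneous. -/
theorem hcRes_smul (hc : c ≤ a) (r : ℂ) (Φ : GL (Fin a) F → ℂ) :
    hcRes hc (r • Φ) = r • hcRes hc Φ := by
  funext x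
  simp only [hcRes, Pi.smul_apply, smul_eq_mul]
  rw [Finset.mul_sum, Finset.mul_sum, Finset.mul_sum]
  refine Finset.sum_congr rfl fun g _ => ?_
  split_ifs <;> ring

/-- `r^a_c (-Φ) = - r^a_c Φ`. -/
theorem hcRes_neg (hc : c ≤ a) (Φ : GL (Fin a) F → ℂ) : hcRes hc (-Φ) = -hcRes hc Φ := by
  rw [← neg_one_smul ℂ Φ, hcRes_smul, neg_one_smul]

/-- `r^a_c (Φ - Ψ) = r^a_c Φ - r^a_c Ψ`. -/
theorem hcRes_sub (hc : c ≤ a) (Φ Ψ : GL (Fin a) F → ℂ) :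
    hcRes hc (Φ - Ψ) = hcRes hc Φ - hcRes hc Ψ := by
  rw [sub_eq_add_neg, hcRes_add, hcRes_neg, ← sub_eq_add_neg]

/-- `r^a_c 0 = 0`. -/
theorem hcRes_zero (hc : c ≤ a) : hcRes hc (0 : GL (Fin a) F → ℂ) = 0 := by
  have h := hcRes_sub hc (0 : GL (Fin a) F → ℂ) 0
  rwa [sub_self, sub_self] at h

/-- `r^a_c` of a finite sum. -/
theorem hcRes_sum (hc : c ≤ a) {ι : Type} (S : Finset ι) (Φ : ι → GL (Fin a) F → ℂ) :
    hcRes hc (∑ i ∈ S, Φ i) = ∑ i ∈ S, hcRes hc (Φ i) := by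
  induction S using Finset.induction_on with
  | empty => simp [hcRes_zero]
  | insert i S hi ih => rw [Finset.sum_insert hi, Finset.sum_insert hi, hcRes_add, ih]

/-- **`r^a_c` preserves class functions.** (Conjugate the summation variable by `lift u ∈ P^a_c`.) -/
theorem isClassFun_hcRes (hc : c ≤ a) {Φ : GL (Fin a) F → ℂ} (hΦ : IsClassFun Φ) :
    IsClassFun (hcRes hc Φ) := by
  intro x u
  simp only [hcRes]
  congr 1
  set w : parab F a c := ⟨lift hc u, lift_mem_parab hc u⟩ with hw
  have hwu : ul hc w = u := ul_lift hc u
  refine Fintype.sum_equiv (MulAut.conj w).symm.toEquiv _ _ fun g => ?_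
  have hg' : ((MulAut.conj w).symm.toEquiv g : parab F a c) = w⁻¹ * g * w := rfl
  rw [hg', map_mul, map_mul, map_inv, hwu]
  have hΦ' : Φ ((w⁻¹ * g * w : parab F a c) : GL (Fin a) F) = Φ g := by
    rw [Subgroup.coe_mul, Subgroup.coe_mul, Subgroup.coe_inv]
    exact hΦ.apply_inv_mul_mul _ _
  rw [hΦ']
  by_cases h : ul hc g = u * x * u⁻¹
  · rw [if_pos h, if_pos]
    rw [h]
    group
  · rw [if_neg h, if_neg]
    intro h'
    apply h
    rw [← h']
    group

/-- **The adjunction `⟨Φ, I^a_c τ⟩_{GL_a} = ⟨r^a_c Φ, τ⟩_{GL_c}`** for a class function `Φ` on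
`GL_a(F)` and any `τ` (Frobenius reciprocity for `P^a_c ≤ GL_a`, then summation along the
fibres of `ul`, each a coset of `Q^a_c`; `|P^a_c| = |Q^a_c| |GL_c|`). -/
theorem classInner_hcInd_right (hc : c ≤ a) {Φ : GL (Fin a) F → ℂ} (hΦ : IsClassFun Φ)
    (τ : GL (Fin c) F → ℂ) : classInner Φ (hcInd hc τ) = classInner (hcRes hc Φ) τ := by
  unfold hcInd
  rw [classInner_indClassFun_right _ _ hΦ, classInner_apply, classInner_apply]
  have hre : ∑ x : GL (Fin c) F, hcRes hc Φ x * τ x⁻¹ =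
      (Nat.card (fixer F a c) : ℂ)⁻¹ * ∑ g : parab F a c, Φ g * τ (ul hc g)⁻¹ := by
    calc ∑ x : GL (Fin c) F, hcRes hc Φ x * τ x⁻¹
        = (Nat.card (fixer F a c) : ℂ)⁻¹ * ∑ x : GL (Fin c) F, ∑ g : parab F a c,
            (if ul hc g = x then Φ g * τ x⁻¹ else 0) := by
          rw [Finset.mul_sum]
          refine Finset.sum_congr rfl fun x _ => ?_
          rw [hcRes, mul_assoc, Finset.sum_mul]
          congr 1
          refine Finset.sum_congr rfl fun g _ => ?_
          split_ifs <;> simp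
      _ = (Nat.card (fixer F a c) : ℂ)⁻¹ * ∑ g : parab F a c, Φ g * τ (ul hc g)⁻¹ := by
          rw [Finset.sum_comm]
          congr 1
          refine Finset.sum_congr rfl fun g _ => ?_
          rw [Finset.sum_ite_eq, if_pos (Finset.mem_univ _)]
  rw [hre]
  have hsum : ∑ g : parab F a c, (fun y : parab F a c => Φ y) g * (fun y : parab F a c => τ (ul hc y)) g⁻¹ =
      ∑ g : parab F a c, Φ g * τ (ul hc g)⁻¹ := by
    refine Finset.sum_congr rfl fun g _ => ?_
    simp only [map_inv]
  rw [hsum, ← Nat.card_eq_fintype_card, ← Nat.card_eq_fintype_card, card_parab hc, Nat.cast_mul,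
    mul_inv, mul_assoc, mul_left_comm]

/-- The adjunction with the induced function on the left: `⟨I^a_c τ, Φ⟩ = ⟨τ, r^a_c Φ⟩`. -/
theorem classInner_hcInd_left (hc : c ≤ a) (τ : GL (Fin c) F → ℂ) {Φ : GL (Fin a) F → ℂ}
    (hΦ : IsClassFun Φ) : classInner (hcInd hc τ) Φ = classInner τ (hcRes hc Φ) := by
  rw [classInner_comm, classInner_hcInd_right hc hΦ, classInner_comm]

/-- **Degree of `I^a_c σ`**: `(I^a_c σ)(1) = [GL_a : P^a_c] · σ(1)`. -/
theorem hcInd_apply_one (hc : c ≤ a) (σ : GL (Fin c) F → ℂ) :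
    hcInd hc σ 1 = (Nat.card (GL (Fin a) F ⧸ parab F a c) : ℂ) * σ 1 := by
  unfold hcInd
  rw [indClassFun_one]
  have h1 : (⟨1, (parab F a c).one_mem⟩ : parab F a c) = 1 := rfl
  rw [h1, map_one]
  have hG : (Fintype.card (GL (Fin a) F) : ℂ) =
      (Nat.card (GL (Fin a) F ⧸ parab F a c) : ℂ) * Nat.card (parab F a c) := by
    rw [← Nat.card_eq_fintype_card, Subgroup.card_eq_card_quotient_mul_card_subgroup (parab F a c),
      Nat.cast_mul]
  rw [hG]
  have hP : (Nat.card (parab F a c) : ℂ) ≠ 0 := by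
    rw [Nat.card_eq_fintype_card]
    exact Nat.cast_ne_zero.mpr Fintype.card_ne_zero
  field_simp

/-- `I^a_a σ = σ` for a class function `σ` (`P^a_a = GL_a`). -/
theorem hcInd_self {σ : GL (Fin a) F → ℂ} (hσ : IsClassFun σ) : hcInd le_rfl σ = σ := by
  funext s
  unfold hcInd
  rw [indClassFun_apply]
  have hterm : ∀ t : GL (Fin a) F, Function.extend (Subtype.val : parab F a a → GL (Fin a) F)
      (fun g : parab F a a => σ (ul le_rfl g)) 0 (t⁻¹ * s * t) = σ s := by
    intro t
    have hmem : t⁻¹ * s * t ∈ parab F a a := by rw [parab_self_eq_top]; exact Subgroup.mem_top _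
    rw [show t⁻¹ * s * t = ((⟨t⁻¹ * s * t, hmem⟩ : parab F a a) : GL (Fin a) F) from rfl,
      extend_subtypeVal_apply]
    show σ (ul le_rfl ⟨t⁻¹ * s * t, hmem⟩) = σ s
    rw [ul_self]
    exact hσ.apply_inv_mul_mul s t
  simp only [hterm, Finset.sum_const, Finset.card_univ, nsmul_eq_mul]
  have hP : (Nat.card (parab F a a) : ℂ) = Fintype.card (GL (Fin a) F) := by
    rw [parab_self_eq_top, Subgroup.card_top, Nat.card_eq_fintype_card]
  rw [hP, ← mul_assoc, inv_mul_cancel₀ (Nat.cast_ne_zero.mpr Fintype.card_ne_zero), one_mul]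

/-- `r^a_a Φ = Φ` (`Q^a_a = 1`). -/
theorem hcRes_self (Φ : GL (Fin a) F → ℂ) : hcRes le_rfl Φ = Φ := by
  funext x
  unfold hcRes
  rw [fixer_self_eq_bot, Subgroup.card_bot, Nat.cast_one, inv_one, one_mul]
  have hx : x ∈ parab F a a := by rw [parab_self_eq_top]; exact Subgroup.mem_top _
  rw [Finset.sum_eq_single (⟨x, hx⟩ : parab F a a)]
  · rw [if_pos (ul_self _)]
  · intro g _ hg
    rw [if_neg]
    intro h
    apply hg
    rw [ul_self] at h
    exact Subtype.ext h
  · intro h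
    exact absurd (Finset.mem_univ _) h

end ParabolicRestriction
end Summit.MatrixMultiplication.MatrixMultiplication.Theorems.SubgroupIdentityDesigns.Negative
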